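import Summits.CriticalPhenomena.SAWScalingLimit.Theorems.SAWLeftRightFKGFKGToTraversalBoundOutlineShared
import Summits.CriticalPhenomena.SAWScalingLimit.Theorems.SAWLeftRightFKGFKGToTraversalBoundOutlinePeriod
import Summits.CriticalPhenomena.SAWScalingLimit.Theorems.SAWLeftRightFKGFKGToTraversalBoundOutlineCycle
import Summits.CriticalPhenomena.SAWScalingLimit.Theorems.SAWLeftRightFKGFKGToTraversalBoundBoundaryBudget
import HarnessLib

/-!
# Boundary-facing windows of the free tour are windows of the carrier tour (witness glue T6b)

Crux `SAWLeftRightFKG.FKGToTraversalBound` (stmt-CriticalPhenomena-1878), line `slit-necklace`, lead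
prover-line-stmt-CriticalPhenomena-1878-c5-0; witness glue T6b (the DOMAIN-BOUNDARY account of the window
accounting), on top of `…OutlineShared` (`btour_shared_order`), `…OutlinePeriod` (`btour_minimalPeriod_surj`),
`…OutlineCycle` (`btour_transitive`), `…OutlineTour` (`btour_add`, `btour_add_of_eq`, `btour_mod_of_eq`) and the
vocabulary `…BoundaryBudget` (`FacesBoundary`).

Registered stub `acc_facing_transfer`.  Pure outline combinatorics: `F ⊆ B ⊆ ℤ²` finite site sets, `F`
`4`-connected, `B` `4`-connected with `4`-connected complement; `e₀` a boundary edge of `F` whose wall-follower tour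
has the injective period `N`; inside one period window `[m, n]`, `n < m + N`, we are given `q` strictly separated
position windows `Pa mm < Pb mm` whose `2q` tour edges have their contact sites OUTSIDE `B` (so they are boundary
edges of `B` too — SHARED edges), face the boundary of the domain, and whose outline sites lie on opposite sides of
the shell `D(y; ρ₁, ρ₂)`.  If every such configuration of windows of the tour of a `B' ` (with the `B`-facts) is
bounded by `nB` (the boundary-budget hypothesis, applied with `B' := B`), then `q ≤ nB`.

Proof.  Re-base both tours at the first shared edge `e := btour F e₀ (Pa 0)`; the `F`-tour from `e` is the shifted
tour (same injective period), the `B`-tour from `e` has a minimal injective period `NB` exhausting its orbit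
(`btour_minimalPeriod_surj`) and passes through every boundary edge of `B` (`btour_transitive`), in particular
through the `2q` shared edges, at positions `la mm, lb mm < NB`.  By `btour_shared_order` the `B`-positions are
ordered like the `F`-positions, so `(la, lb)` is again a family of strictly separated windows, with the same edges —
hence the same sides and the same facing property — and the budget hypothesis bounds `q`.

All statements folklore (boundary tracing of a polyomino); no literature fact is introduced; nothing restates the
crux.
-/

noncomputable section

open Set
open Literature.Probability.LatticeModels
open Literature.Probability.RandomPlanarGeometry

namespace Summit.CriticalPhenomena.SAWScalingLimit.Theorems.FKGToTraversalBound.SlitNecklace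

/-! ### Re-basing the two tours at a shared edge -/

/-- Shifting the start of an injective period: the tour re-based at `btour A e₀ P` is again injective on
`[0, N)` (reduce modulo the period and cancel `P`, as in `btour_abab`). [folklore] -/
private theorem ft_shift_inj (A : Set (Site 2)) {e₀ : Site 2 × ODir} {N : ℕ} (hN : btour A e₀ N = e₀)
    (hinj : ∀ j j', j < N → j' < N → btour A e₀ j = btour A e₀ j' → j = j') (P : ℕ) :
    ∀ j j', j < N → j' < N → btour A (btour A e₀ P) j = btour A (btour A e₀ P) j' → j = j' := by
  -- adapted from `btour_abab` (…OutlineAbab)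
  have hshift : ∀ k, btour A (btour A e₀ P) k = btour A e₀ (P + k) := fun k => (btour_add A e₀ P k).symm
  intro j j' hj hj' h
  have hNpos : 0 < N := by omega
  rw [hshift, hshift, ← btour_mod_of_eq _ hN (P + j), ← btour_mod_of_eq _ hN (P + j')] at h
  have hmod : j % N = j' % N :=
    Nat.ModEq.add_left_cancel' P (hinj _ _ (Nat.mod_lt _ hNpos) (Nat.mod_lt _ hNpos) h)
  rwa [Nat.mod_eq_of_lt hj, Nat.mod_eq_of_lt hj'] at hmod

/-- **Monotonicity of the `B`-position along the `F`-tour.**  Both tours based at the shared edge `e`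
(`F`-period `N`, `B`-period `NB`, both injective); shared edges at `F`-positions `p < p' < N` met by the `B`-tour
at positions `l, l' < NB` satisfy `l < l'`.  For `p = 0` the edge is `e` itself, so `l = 0 < l'`; for `0 < p`
this is `btour_shared_order`. [folklore] -/
private theorem ft_order {F B : Finset (Site 2)} {e : Site 2 × ODir} {N NB : ℕ} (hFB : F ⊆ B)
    (hF : ∀ x ∈ F, ∀ x' ∈ F, ∃ w : (zdGraph 2).Walk x x', ∀ z ∈ w.support, z ∈ F)
    (hBc : ∀ x x' : Site 2, x ∉ B → x' ∉ B → ∃ w : (zdGraph 2).Walk x x', ∀ z ∈ w.support, z ∉ B)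
    (he : IsBEdge (↑F : Set (Site 2)) e) (hc : bcontact e ∉ B) (hN : btour (↑F : Set (Site 2)) e N = e)
    (hinj : ∀ j j', j < N → j' < N →
      btour (↑F : Set (Site 2)) e j = btour (↑F : Set (Site 2)) e j' → j = j')
    (hNB : btour (↑B : Set (Site 2)) e NB = e)
    (hinjB : ∀ j j', j < NB → j' < NB →
      btour (↑B : Set (Site 2)) e j = btour (↑B : Set (Site 2)) e j' → j = j')
    {p p' l l' : ℕ} (hpp' : p < p') (hp'N : p' < N) (hl : l < NB) (hl' : l' < NB)
    (hle : btour (↑B : Set (Site 2)) e l = btour (↑F : Set (Site 2)) e p)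
    (hle' : btour (↑B : Set (Site 2)) e l' = btour (↑F : Set (Site 2)) e p')
    (hcp : bcontact (btour (↑F : Set (Site 2)) e p) ∉ B)
    (hcp' : bcontact (btour (↑F : Set (Site 2)) e p') ∉ B) : l < l' := by
  have hNBpos : 0 < NB := by omega
  have hNpos : 0 < N := by omega
  -- the edge at `p'` is not the base edge, so `l' ≠ 0`
  have hl'0 : 0 < l' := by
    rcases Nat.eq_zero_or_pos l' with rfl | h
    · exfalso
      rw [btour_zero] at hle'
      have := hinj 0 p' hNpos hp'N (by rw [btour_zero]; exact hle')
      omega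
    · exact h
  rcases Nat.eq_zero_or_pos p with rfl | hp0
  · -- base position: `l = 0`
    have : l = 0 := hinjB l 0 hl hNBpos (by rw [hle, btour_zero, btour_zero])
    omega
  · have hl0 : 0 < l := by
      rcases Nat.eq_zero_or_pos l with rfl | h
      · exfalso
        rw [btour_zero] at hle
        have := hinj 0 p hNpos (by omega) (by rw [btour_zero]; exact hle)
        omega
      · exact h
    exact btour_shared_order F B e N NB p p' l l' hFB hF hBc he hc hN hinj hNB hinjB hp0 hpp' hp'N hl0 hl
      hl'0 hl' hle hle' hcp hcp'

/-! ### The registered stub -/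

/-- **Registered stub (witness glue T6b): boundary-facing windows of the free tour transfer to the carrier tour
and are bounded by the boundary budget.**  `F ⊆ B`, `F` `4`-connected, `B` `4`-connected with `4`-connected
complement; `q` strictly separated windows of the injective `F`-tour period through `[m, n]` whose end edges have
contacts outside `B`, face `∂D` and have outline sites on opposite sides of the shell `D(y; ρ₁, ρ₂)`; then the
boundary-budget hypothesis for `B` gives `q ≤ nB`.  Proof: re-base at the first shared edge, locate the `2q`
shared edges on the `B`-tour (`btour_transitive`, `btour_minimalPeriod_surj`), order them by
`btour_shared_order`, and apply the hypothesis with `B' := B`. [folklore] -/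
theorem acc_facing_transfer : ∀ (D : DobrushinDomain) (δ : ℝ) (F B : Finset (Site 2)) (e₀ : Site 2 × ODir) (N m n : ℕ) (y : ℂ) (ρ₁ ρ₂ : ℝ) (nB q : ℕ) (Pa Pb : Fin q → ℕ), F ⊆ B → (∀ x ∈ F, ∀ x' ∈ F, ∃ w : (zdGraph 2).Walk x x', ∀ z ∈ w.support, z ∈ F) → (∀ x ∈ B, meshPoint δ x ∈ D.carrier) → (∀ x ∈ B, ∀ x' ∈ B, (zdGraph 2).Adj x x' → (discreteDomainGraph D.carrier δ).Adj x x') → (∀ x ∈ B, ∀ x' ∈ B, ∃ w : (zdGraph 2).Walk x x', ∀ z ∈ w.support, z ∈ B) → (∀ x x' : Site 2, x ∉ B → x' ∉ B → ∃ w : (zdGraph 2).Walk x x', ∀ z ∈ w.support, z ∉ B) → IsBEdge (↑F : Set (Site 2)) e₀ → 0 < N → btour (↑F : Set (Site 2)) e₀ N = e₀ → (∀ j j', j < N → j' < N → btour (↑F : Set (Site 2)) e₀ j = btour (↑F : Set (Site 2)) e₀ j' → j = j') → m ≤ n → n < m + N → (∀ mm, m ≤ Pa mm ∧ Pa mm <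 Pb mm ∧ Pb mm ≤ n) → (∀ ⦃mm mm' : Fin q⦄, mm < mm' → Pb mm < Pa mm') → (∀ mm, bcontact (btour (↑F : Set (Site 2)) e₀ (Pa mm)) ∉ B ∧ bcontact (btour (↑F : Set (Site 2)) e₀ (Pb mm)) ∉ B) → (∀ mm, FacesBoundary D.carrier δ (btour (↑F : Set (Site 2)) e₀ (Pa mm)) ∧ FacesBoundary D.carrier δ (btour (↑F : Set (Site 2)) e₀ (Pb mm))) → (∀ mm, (dist (meshPoint δ (bsite (btour (↑F : Set (Site 2)) e₀ (Pa mm)))) y ≤ ρ₁ ∧ ρ₂ ≤ dist (meshPoint δ (bsite (btour (↑F : Set (Site 2)) e₀ (Pb mm)))) y) ∨ (ρ₂ ≤ dist (meshPoint δ (bsite (btour (↑F : Set (Site 2)) e₀ (Pa mm)))) y ∧ dist (meshPoint δ (bsite (btour (↑F : Set (Site 2)) e₀ (Pb mm)))) y ≤ ρ₁)) → (∀ (B' : Finset (Site 2)) (e : Site 2 × ODir) (N' q' : ℕ) (a b : Fin q' → ℕ), (∀ x ∈ B', meshPoint δ x ∈ D.carrier) → (∀ x ∈ B', ∀ x' ∈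 B', (zdGraph 2).Adj x x' → (discreteDomainGraph D.carrier δ).Adj x x') → (∀ x ∈ B', ∀ x' ∈ B', ∃ w : (zdGraph 2).Walk x x', ∀ z ∈ w.support, z ∈ B') → (∀ x x' : Site 2, x ∉ B' → x' ∉ B' → ∃ w : (zdGraph 2).Walk x x', ∀ z ∈ w.support, z ∉ B') → IsBEdge (↑B' : Set (Site 2)) e → 0 < N' → btour (↑B' : Set (Site 2)) e N' = e → (∀ j j', j < N' → j' < N' → btour (↑B' : Set (Site 2)) e j = btour (↑B' : Set (Site 2)) e j' → j = j') → (∀ mm, a mm < b mm ∧ b mm < N') → (∀ ⦃mm mm' : Fin q'⦄, mm < mm' → b mm < a mm') → (∀ mm, (dist (meshPoint δ (bsite (btour (↑B' : Set (Site 2)) e (a mm)))) y ≤ ρ₁ ∧ ρ₂ ≤ dist (meshPoint δ (bsite (btour (↑B' : Set (Site 2)) e (b mm)))) y) ∨ (ρ₂ ≤ dist (meshPoint δ (bsite (btour (↑B' : Set (Site 2)) e (a mm)))) y ∧ dist (meshPoint δ (bsite (btour (↑B' : Set (Site 2)) e (b mm)))) y ≤ ρ₁)) → (∀ mm, FacesBoundary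 D.carrier δ (btour (↑B' : Set (Site 2)) e (a mm)) ∧ FacesBoundary D.carrier δ (btour (↑B' : Set (Site 2)) e (b mm))) → q' ≤ nB) → q ≤ nB := by
  classical
  intro D δ F B e₀ N m n y ρ₁ ρ₂ nB q Pa Pb hFB hF hBD hBadj hB hBc he₀ hN hper hinj hmn hnm hP hsep hcontact
    hface hside hBB
  rcases Nat.eq_zero_or_pos q with hq | hq
  · omega
  -- the base: the start of the first window, a shared edge `e`
  obtain ⟨mm₀, hmm₀⟩ : ∃ mm₀ : Fin q, (mm₀ : ℕ) = 0 := ⟨⟨0, hq⟩, rfl⟩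
  have hP₀ : ∀ mm, Pa mm₀ ≤ Pa mm := by
    intro mm
    by_cases h : mm₀ < mm
    · exact ((hP mm₀).2.1.trans (hsep h)).le
    · have hmm : mm = mm₀ := Fin.ext (by rw [Fin.not_lt, Fin.le_def] at h; omega)
      rw [hmm]
  have hFB' : (↑F : Set (Site 2)) ⊆ (↑B : Set (Site 2)) := Finset.coe_subset.2 hFB
  obtain ⟨e, he⟩ : ∃ e, btour (↑F : Set (Site 2)) e₀ (Pa mm₀) = e := ⟨_, rfl⟩
  have heF : IsBEdge (↑F : Set (Site 2)) e := he ▸ btour_isBEdge _ he₀ (Pa mm₀)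
  have hce : bcontact e ∉ B := he ▸ (hcontact mm₀).1
  have heB : IsBEdge (↑B : Set (Site 2)) e := ⟨hFB' heF.1, hce⟩
  -- the `F`-tour re-based at `e`
  have hshift : ∀ k, btour (↑F : Set (Site 2)) e k = btour (↑F : Set (Site 2)) e₀ (Pa mm₀ + k) := by
    intro k
    rw [← he, ← btour_add]
  have hperF : btour (↑F : Set (Site 2)) e N = e := by
    rw [hshift, btour_add_of_eq _ hper]
    exact he
  have hinjF := ft_shift_inj (↑F : Set (Site 2)) hper hinj (Pa mm₀)
  rw [he] at hinjF
  have hrel : ∀ P, Pa mm₀ ≤ P → btour (↑F : Set (Site 2)) e (P - Pa mm₀) = btour (↑F : Set (Site 2)) e₀ P := by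
    intro P hP'
    rw [hshift, Nat.add_sub_cancel' hP']
  -- the `B`-tour based at `e`: minimal injective period, exhausting all boundary edges of `B`
  obtain ⟨NB, hNBpos, hNBper, hNBinj, hNBsurj⟩ := btour_minimalPeriod_surj B heB
  have hidx : ∀ E : Site 2 × ODir, IsBEdge (↑B : Set (Site 2)) E →
      ∃ l, l < NB ∧ btour (↑B : Set (Site 2)) e l = E := by
    intro E hE
    obtain ⟨l, hl⟩ := btour_transitive B ⟨_, Finset.mem_coe.1 heB.1⟩ hB hBc e E heB hE
    obtain ⟨l', hl', hll'⟩ := hNBsurj l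
    exact ⟨l', hl', by rw [← hll']; exact hl⟩
  have hEa : ∀ mm, IsBEdge (↑B : Set (Site 2)) (btour (↑F : Set (Site 2)) e₀ (Pa mm)) := fun mm =>
    ⟨hFB' (btour_isBEdge _ he₀ (Pa mm)).1, (hcontact mm).1⟩
  have hEb : ∀ mm, IsBEdge (↑B : Set (Site 2)) (btour (↑F : Set (Site 2)) e₀ (Pb mm)) := fun mm =>
    ⟨hFB' (btour_isBEdge _ he₀ (Pb mm)).1, (hcontact mm).2⟩
  choose la hla using fun mm => hidx _ (hEa mm)
  choose lb hlb using fun mm => hidx _ (hEb mm)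
  -- position bounds within the period window based at `Pa mm₀`
  have hbound : ∀ mm, Pa mm₀ ≤ Pa mm ∧ Pa mm < Pb mm ∧ Pb mm < Pa mm₀ + N := by
    intro mm
    refine ⟨hP₀ mm, (hP mm).2.1, ?_⟩
    have h1 := (hP mm).2.2
    have h2 := (hP mm₀).1
    omega
  -- the `B`-windows
  have hwin : ∀ mm, la mm < lb mm ∧ lb mm < NB := by
    intro mm
    obtain ⟨h1, h2, h3⟩ := hbound mm
    refine ⟨ft_order hFB hF hBc heF hce hperF hinjF hNBper hNBinj (p := Pa mm - Pa mm₀)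
      (p' := Pb mm - Pa mm₀) (by omega) (by omega) (hla mm).1 (hlb mm).1
      (by rw [(hla mm).2, hrel _ h1]) (by rw [(hlb mm).2, hrel _ (by omega)])
      (by rw [hrel _ h1]; exact (hcontact mm).1) (by rw [hrel _ (by omega)]; exact (hcontact mm).2),
      (hlb mm).1⟩
  have hsep' : ∀ ⦃mm mm' : Fin q⦄, mm < mm' → lb mm < la mm' := by
    intro mm mm' hlt
    obtain ⟨h1, h2, h3⟩ := hbound mm
    obtain ⟨h1', h2', h3'⟩ := hbound mm'
    have hs := hsep hlt
    exact ft_order hFB hF hBc heF hce hperF hinjF hNBper hNBinj (p := Pb mm - Pa mm₀)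
      (p' := Pa mm' - Pa mm₀) (by omega) (by omega) (hlb mm).1 (hla mm').1
      (by rw [(hlb mm).2, hrel _ (by omega)]) (by rw [(hla mm').2, hrel _ h1'])
      (by rw [hrel _ (by omega)]; exact (hcontact mm).2) (by rw [hrel _ h1']; exact (hcontact mm').1)
  -- apply the budget hypothesis with `B' := B`
  exact hBB B e NB q la lb hBD hBadj hB hBc heB hNBpos hNBper hNBinj hwin hsep'
    (fun mm => by rw [(hla mm).2, (hlb mm).2]; exact hside mm)
    (fun mm => by rw [(hla mm).2, (hlb mm).2]; exact hface mm)

end Summit.CriticalPhenomena.SAWScalingLimit.Theorems.FKGToTraversalBound.SlitNecklace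

end
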